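import Literature.AlgebraicGeometry.ShimuraVarieties.RapoportSmithlingZhang2020.Sec3IntegralModels
import HarnessLib

/-!
# [RapoportSmithlingZhang2020, §3.1 Remark 3.1] the Harris–Taylor case `E = φ₀(F)` — DISCHARGED: `Rem31_harrisTaylor_holds`

Kernel-lane companion of the statement carpet ★ `Literature/AlgebraicGeometry/ShimuraVarieties/RapoportSmithlingZhang2020/
Sec3IntegralModels.lean`: the named fact ★ `Sec3Data.Rem31_harrisTaylor` — «When `F` is of the form `K F₀` for an imaginary
quadratic field `K/ℚ` and `Φ` is the unique CM type induced from `K` containing `φ₀` (the case taken by Harris–Taylor), `φ₀`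
identifies `F ≅ E`», typed as `E = E_Φ · φ₀(F) = φ₀(F)` for `Φ = {φ ∣ φ|_K = φ₀|_K}` — now has its `_holds` theorem.

## Proof

`E_Φ = ℚ(tr_Φ(x) ∣ x ∈ F)` (★ `ComplexMultiplication.traceField`, Shimura's `ℚ(∑ᵢ ξ^{φᵢ})`), so it suffices that every type
trace `tr_Φ(x) = ∑_{φ ∈ Φ} φ(x)` lies in `φ₀(F)`.  The embeddings `φ : F → ℂ` with `φ|_K = φ₀|_K` are exactly the `K`-algebra
homomorphisms `F →ₐ[K] ℂ` for the `K`-algebra structure `φ₀|_K` on `ℂ`, and Mathlib's `trace_eq_sum_embeddings` gives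
`∑_{σ : F →ₐ[K] ℂ} σ(x) = φ₀(Tr_{F/K}(x)) ∈ φ₀(F)`.  (The printed hypotheses `[K : ℚ] = 2` and `K · F₀ = F` are not needed for this
inclusion.)

No new definitions, no new named facts (D-0026).
-/

namespace Literature.AlgebraicGeometry.ShimuraVarieties.RapoportSmithlingZhang2020.Sec3IntegralModels

open NumberField
open Literature.AlgebraicGeometry.Motives (CMType)
open Literature.NumberTheory.ComplexMultiplication (traceField cmTypeTrace cmTypeTrace_apply)

variable {F₀ F : Type} [Field F₀] [NumberField F₀] [IsTotallyReal F₀] [Field F] [NumberField F] [Algebra F₀ F]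
  [IsTotallyComplex F] [Algebra.IsQuadraticExtension F₀ F]

namespace Sec3Data

omit [IsTotallyComplex F] in
/-- **The type trace of an induced type is a field trace**: if `Φ = {φ : F → ℂ ∣ φ|_K = φ₀|_K}` for a subfield `K ⊆ F`, then
`tr_Φ(x) = ∑_{φ ∈ Φ} φ(x) = φ₀(Tr_{F/K}(x))` (Mathlib `trace_eq_sum_embeddings` for the `K`-algebra `ℂ` via `φ₀|_K`).
[cite: Shimura1998, §8.3 Prop. 28] -/
private theorem cmTypeTrace_eq_apply_trace (Φ : CMType F) (φ₀ : F →+* ℂ) (K : IntermediateField ℚ F)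
    (hΦ : ∀ φ : F →+* ℂ, φ ∈ Φ.1 ↔ ∀ x : K, φ (x : F) = φ₀ (x : F)) (x : F) :
    cmTypeTrace Φ x = φ₀ ((Algebra.trace K F x : K) : F) := by
  classical
  letI : Algebra K ℂ := (φ₀.comp (algebraMap K F)).toAlgebra
  have halg : ∀ y : K, algebraMap K ℂ y = φ₀ (y : F) := fun y => rfl
  -- Mathlib: `φ₀(Tr_{F/K} x) = ∑_{σ : F →ₐ[K] ℂ} σ x`
  have hsum : algebraMap K ℂ (Algebra.trace K F x) = ∑ σ : F →ₐ[K] ℂ, σ x := trace_eq_sum_embeddings ℂ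
  rw [halg] at hsum
  rw [hsum, cmTypeTrace_apply]
  -- reindex the sum over `Φ` by the `K`-algebra homomorphisms
  refine Finset.sum_bij (fun (φ : F →+* ℂ) (hφ : φ ∈ (Set.toFinite Φ.1).toFinset) =>
      ({ φ with commutes' := fun y => ((hΦ φ).1 ((Set.Finite.mem_toFinset _).1 hφ) y).trans (halg y).symm } :
        F →ₐ[K] ℂ)) (fun _ _ => Finset.mem_univ _) (fun φ₁ _ φ₂ _ h => ?_) (fun σ _ => ?_) (fun _ _ => rfl)
  · exact RingHom.ext fun y => by simpa using congrArg (fun f : F →ₐ[K] ℂ => f y) h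
  · refine ⟨σ.toRingHom, (Set.Finite.mem_toFinset _).2 ((hΦ _).2 fun y => ?_), AlgHom.ext fun _ => rfl⟩
    simpa [halg] using σ.commutes y

variable (D : Sec3Data F₀ F)

/-- **[RSZ2020, Remark 3.1, first sentence] — DISCHARGED**: in the Harris–Taylor case (`K ⊆ F` quadratic with `K · F₀ = F` and
`Φ = {φ ∣ φ|_K = φ₀|_K}`), `E = E_Φ · φ₀(F) = φ₀(F)`: every type trace `∑_{φ ∈ Φ} φ(x) = φ₀(Tr_{F/K} x)` lies in `φ₀(F)`, so
`E_Φ ≤ φ₀(F)`. [cite: RapoportSmithlingZhang2020Diagonal, §3.1 Remark 3.1 p. 9] -/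
theorem Rem31_harrisTaylor_holds : D.Rem31_harrisTaylor := by
  intro K _ _ hΦ
  show traceField D.Φ ⊔ D.φ₀.toRatAlgHom.fieldRange = D.φ₀.toRatAlgHom.fieldRange
  refine sup_eq_right.2 (IntermediateField.adjoin_le_iff.2 ?_)
  rintro _ ⟨x, rfl⟩
  exact ⟨((Algebra.trace K F x : K) : F), (cmTypeTrace_eq_apply_trace D.Φ D.φ₀ K hΦ x).symm⟩

end Sec3Data

end Literature.AlgebraicGeometry.ShimuraVarieties.RapoportSmithlingZhang2020.Sec3IntegralModels
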